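import Mathlib
import HarnessLib
import HarnessLib.Audit
import Summits.HodgeConjecture.HodgeConjecture.Theses.EightfoldTwistedSheafSeeds
import Literature.AlgebraicGeometry.HodgeTheory.WeilClassesFourfoldsProofs
import Literature.AlgebraicGeometry.Motives.AbelianVarietyProductDimProofs
import Literature.AlgebraicGeometry.Motives.AimedSplitProductDischarge
import Literature.NumberTheory.EllipticCurves.CMEndomorphismOfMulMemLattice

/-!
# Skeleton `Lines/pad4-cm-anchor` for crux `BlochSeedsGeneric` (stmt-HodgeConjecture-18880)

HONEST FRAMING: a crux PROOF SKELETON (cruxes-workfile class), not a proof. The crux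
`Theses.EightfoldTwistedSheafSeeds.BlochSeedsGeneric = ∀ d, 0 < d → d ≠ 1 → d ≠ 3 → HasHyperbolicBlochSeed 4 d` is NOT proved here: the `sorry`s sit
exactly inside the registered `stub_*` declarations. Nothing here proves rung H2, `WeilSixfolds`, HC_AV or HC.

STRATEGY (line-writer seat `linewriter-hodgeav-h2sheaf` g0, 2026-08-31) — THE PINNED-ANCHOR SHAPE OF THE `d = 1` BIRTH
LINE (`Cruxes/BlochSeedDiscOne/Lines/birth.lean`, route EightfoldBlochSeeds), MADE PARAMETRIC IN THE DISCRIMINANT: for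
every discriminant `d ≥ 1` (the route uses `d ≠ 1, 3`) the tree CONSTRUCTS a CM elliptic curve `E₀` with `ψ₀ ≫ ψ₀ = -d`
(`Literature.NumberTheory.EllipticCurves.CMEndomorphism.exists_cmCurve_sqrt_neg d`), and the anchor is the padded Weil
surface `S⁴`, `S = E₀ × E₀`, `φ_S = ψ₀ × (-ψ₀)` (signature `(1,1)` per factor, hence `(4,4)`; with a product polarisation
each factor is an isotropic hermitian `K`-plane, so `S⁴` is HYPERBOLIC for every `d`). The existential crux `∃ P …` is
thereby reduced to a statement about ONE explicit family of abelian eightfolds per `d`: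

* `stub_rung_pad4_seedAt` — RUNG / THE BET (load-bearing): on `S⁴(E₀)` with `ψ = φ_S⁴`, a projective embedding `e`, a
  rational `a ≠ 0` with `(S⁴, ψ, h_K)` hyperbolic, a non-zero rational Weil class `w ∈ W_K`, and a Bloch seed for
  `q·h_K⁴ + w` (an integral lci Bloch-semiregular fourfold `Z ⊂ S⁴` carrying the class). Technique foreseen (as at
  `d = 1`): zero locus of a regular section of a rank-4 bundle `𝓔` designed from `K`-eigen-line-bundles so that
  `c₄(𝓔) = q·h_K⁴ + w_μ`, `μ ≠ 0`; Fulton–Lazarsfeld connectedness for integrality; `σ`-injectivity certified on the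
  Koszul model. Outside the known regime: no hyperbolic Bloch seed is known in print for any `d` at `n = 4`
  ([Markman2025SecantWeil] §1.5 asks for exactly such seeds; fourfolds `n = 2` are the known window).
* `stub_pad4_carrier` — SUB-RUNG (the class/carrier half, semiregularity clause deleted: `HasLciCarrierAt`); on path
  (`pad4_carrier_of_seedAt`: rung ⟹ sub-rung), open on its own, NOT a witness of the lever by itself.

COMPOSITION `BlochSeedsGeneric_of_pad4` (sorry-free given the stubs): `exists_cmCurve_sqrt_neg d` ▸ `pad4Anchor_dim` ▸
`pad4Action_comp_self` ▸ `stub_rung_pad4_seedAt`.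

WHY ONE LOAD-BEARING STUB (honest): an existential crux pinned to a named anchor has no sound two-piece split — the
anchor's hyperbolicity cannot be separated from the seed without quantifying the seed over ALL hyperbolic
polarisations (a different, harder design problem per `h_K`), and «carrier» ∧ «semiregularity» is not an implication
split (semiregularity is a property of the specific `Z`). Same shape as the accepted `d = 1` birth line.

Negatives honoured (`ledger negatives --problem HodgeConjecture`): none is seed-shaped at `n = 4`; the `n = 2` window and
`schoenCycle_not_blochSemiregular` concern other anchors.

References: [Bloch1972Semiregularity] Thm. (7.4), Remark (7.5); [BuchweitzFlenner2003] Thm. 5.2; [Markman2025SecantWeil]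
§1.5; [vanGeemen1994HodgeAV] 5.3–5.5; [Fulton1998] Ex. 14.1.1, §14.4; [MumfordAV1970] §16.
-/

noncomputable section

-- single-problem summit (Problem = Summit): the mandated namespace repeats `HodgeConjecture`.
set_option linter.dupNamespace false

open CategoryTheory AlgebraicGeometry
open Literature.AlgebraicGeometry Literature.AlgebraicGeometry.Motives Literature.AlgebraicGeometry.HodgeTheory
open Literature.AlgebraicTopology.SingularHomology

namespace Summit.HodgeConjecture.HodgeConjecture.Cruxes.BlochSeedsGeneric.Pad4CMAnchor

/-! ## §0 The anchor `S⁴(E₀)`, `S = E₀ × E₀`, `φ_S = ψ₀ × (-ψ₀)` (verbatim the `d = 1` birth line) -/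

section Anchor

variable (E₀ : AbelianVariety ℂ) (ψ₀ : E₀ ⟶ E₀)

/-- The Weil surface `S = E₀ × E₀`. -/
abbrev weilSurf : AbelianVariety ℂ := E₀.prod E₀

/-- Its Weil action `φ_S = ψ₀ × (-ψ₀)`. -/
abbrev weilSurfAct : weilSurf E₀ ⟶ weilSurf E₀ :=
  AbelianVariety.prodLift (AbelianVariety.fst E₀ E₀ ≫ ψ₀) (AbelianVariety.snd E₀ E₀ ≫ (-ψ₀))

/-- `S² = S × S`. -/
abbrev pad2Anchor : AbelianVariety ℂ := (weilSurf E₀).prod (weilSurf E₀)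
/-- `S³ = S² × S`. -/
abbrev pad3Anchor : AbelianVariety ℂ := (pad2Anchor E₀).prod (weilSurf E₀)
/-- The PAD-4 anchor `S⁴ = S³ × S`. -/
abbrev pad4Anchor : AbelianVariety ℂ := (pad3Anchor E₀).prod (weilSurf E₀)

/-- Product action on `S²`. -/
abbrev pad2Action : pad2Anchor E₀ ⟶ pad2Anchor E₀ :=
  AbelianVariety.prodLift (AbelianVariety.fst _ _ ≫ weilSurfAct E₀ ψ₀) (AbelianVariety.snd _ _ ≫ weilSurfAct E₀ ψ₀)
/-- Product action on `S³`. -/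
abbrev pad3Action : pad3Anchor E₀ ⟶ pad3Anchor E₀ :=
  AbelianVariety.prodLift (AbelianVariety.fst _ _ ≫ pad2Action E₀ ψ₀) (AbelianVariety.snd _ _ ≫ weilSurfAct E₀ ψ₀)
/-- The PAD-4 action on `S⁴`. -/
abbrev pad4Action : pad4Anchor E₀ ⟶ pad4Anchor E₀ :=
  AbelianVariety.prodLift (AbelianVariety.fst _ _ ≫ pad3Action E₀ ψ₀) (AbelianVariety.snd _ _ ≫ weilSurfAct E₀ ψ₀)

/-- The `K`-symmetrised hyperplane class `h_K(e, a) = d·ι^*a + ψ^*ι^*a` (the literal shape inside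
`HasHyperbolicBlochSeed 4 d`). -/
abbrev symH (d : ℕ) {P : AbelianVariety ℂ} (ψ : P ⟶ P) (e : ProjectiveEmbedding P.X)
    (a : complexBetti (projectiveSpace e.n ℂ) 2) : complexBetti P.X 2 :=
  (d : ℂ) • complexBetti.map e.ι 2 a + complexBetti.map ψ.hom.hom.hom 2 (complexBetti.map e.ι 2 a)

variable {E₀ ψ₀}

/-- `dim S = 2·1`. -/
theorem weilSurf_dim (hE : E₀.dim = 1) : (weilSurf E₀).dim = 2 * 1 := by
  show (E₀.prod E₀).dim = 2 * 1
  rw [AbelianVariety.dim_prod, hE]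

/-- `dim S⁴ = 2·4`. -/
theorem pad4Anchor_dim (hE : E₀.dim = 1) : (pad4Anchor E₀).dim = 2 * 4 := by
  have h1 := weilSurf_dim hE
  have h2 : (pad2Anchor E₀).dim = 2 * (1 + 1) := dim_prod_eq_two_mul h1 h1
  have h3 : (pad3Anchor E₀).dim = 2 * ((1 + 1) + 1) := dim_prod_eq_two_mul h2 h1
  have h4 : (pad4Anchor E₀).dim = 2 * (((1 + 1) + 1) + 1) := dim_prod_eq_two_mul h3 h1
  simpa using h4

variable {d : ℕ}

/-- `(-ψ₀)² = ψ₀²`. -/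
theorem neg_comp_neg_eq (hψ : ψ₀ ≫ ψ₀ = -(d • 𝟙 E₀)) : (-ψ₀) ≫ (-ψ₀) = -(d • 𝟙 E₀) := by
  rw [Preadditive.neg_comp_neg]; exact hψ

/-- `φ_S ≫ φ_S = -d`. -/
theorem weilSurfAct_comp_self (hψ : ψ₀ ≫ ψ₀ = -(d • 𝟙 E₀)) :
    weilSurfAct E₀ ψ₀ ≫ weilSurfAct E₀ ψ₀ = -(d • 𝟙 (weilSurf E₀)) :=
  prodLift_comp_self_eq_neg_nsmul hψ (neg_comp_neg_eq hψ)

/-- `ψ ≫ ψ = -d` on `S⁴`. -/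
theorem pad4Action_comp_self (hψ : ψ₀ ≫ ψ₀ = -(d • 𝟙 E₀)) :
    pad4Action E₀ ψ₀ ≫ pad4Action E₀ ψ₀ = -(d • 𝟙 (pad4Anchor E₀)) := by
  have hS := weilSurfAct_comp_self hψ
  have h2 : pad2Action E₀ ψ₀ ≫ pad2Action E₀ ψ₀ = -(d • 𝟙 (pad2Anchor E₀)) :=
    prodLift_comp_self_eq_neg_nsmul hS hS
  have h3 : pad3Action E₀ ψ₀ ≫ pad3Action E₀ ψ₀ = -(d • 𝟙 (pad3Anchor E₀)) :=
    prodLift_comp_self_eq_neg_nsmul h2 hS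
  exact prodLift_comp_self_eq_neg_nsmul h3 hS

end Anchor

/-! ## §1 The carrier truncation (sub-rung vocabulary) -/

/-- An integral lci CARRIER of `q·hⁿ + w` on `P` = `HasBlochSeedAt n P h w` with the Bloch-semiregularity clause
deleted (all other conjuncts verbatim). Sub-rung vocabulary only. -/
def HasLciCarrierAt (n : ℕ) (P : AbelianVariety ℂ) (h : complexBetti P.X 2) (w : complexBetti P.X (2 * n)) : Prop :=
  ∃ (Z : Scheme.{0}) (i : Z ⟶ P.X.left) (q : ℚ),
    IsClosedImmersion i ∧ IsRegularImmersionOfCodim i n ∧ AlgebraicGeometry.IsIntegral Z ∧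
    (∀ z ∈ Set.range i.base, (n : ℕ∞) ≤ Order.coheight z) ∧
    ((q : ℚ) : ℂ) • cupPowTwo h n + w ∈ classesSupportedOn P.X (Set.range i.base) (2 * n)

/-- A Bloch seed is in particular an lci carrier. -/
theorem hasLciCarrierAt_of_hasBlochSeedAt {n : ℕ} {P : AbelianVariety ℂ} {h : complexBetti P.X 2}
    {w : complexBetti P.X (2 * n)} (hS : HasBlochSeedAt n P h w) : HasLciCarrierAt n P h w := by
  obtain ⟨Z, i, q, hi, hreg, hint, hcoh, -, hsupp⟩ := hS
  exact ⟨Z, i, q, hi, hreg, hint, hcoh, hsupp⟩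

/-! ## §2 Registered stubs -/

/-- **STUB R — THE RUNG and THE BET (load-bearing): a hyperbolic Bloch seed with non-zero `K`-Weil part ON THE PAD-4
CM ANCHOR `S⁴(E₀)`, every discriminant `d ≥ 1` (the route uses `d ≠ 1, 3`).** [cite: Bloch1972Semiregularity, Remark (7.5)] [cite: Markman2025SecantWeil, §1.5]
[cite: Fulton1998, Ex. 14.1.1] -/
theorem stub_rung_pad4_seedAt (d : ℕ) (hd : 0 < d) (E₀ : AbelianVariety ℂ) (ψ₀ : E₀ ⟶ E₀) (hE : E₀.dim = 1)
    (hψ : ψ₀ ≫ ψ₀ = -(d • 𝟙 E₀)) :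
    ∃ (e : ProjectiveEmbedding (pad4Anchor E₀).X) (a : complexBetti (projectiveSpace e.n ℂ) 2)
      (w : complexBetti (pad4Anchor E₀).X (2 * 4)),
      IsRationalClass a ∧ a ≠ 0 ∧
      IsHyperbolicWeilType (pad4Anchor E₀) (pad4Action E₀ ψ₀) 4 (symH d (pad4Action E₀ ψ₀) e a) ∧
      w ∈ weilClassesOf (pad4Anchor E₀) (pad4Action E₀ ψ₀) 4 d ∧ IsRationalClass w ∧ w ≠ 0 ∧
      HasBlochSeedAt 4 (pad4Anchor E₀) (symH d (pad4Action E₀ ψ₀) e a) w := by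
  sorry

/-- **STUB C — SUB-RUNG (the class/carrier half; strictly weaker than STUB R, see `pad4_carrier_of_seedAt`): an
integral lci fourfold on `S⁴(E₀)` carrying `q·h_K⁴ + w` with `w ≠ 0` rational in the `K`-Weil plane, every discriminant `d ≥ 1` (the route uses `d ≠ 1, 3`).**
[cite: Fulton1998, Ex. 14.1.1 and §14.4] -/
theorem stub_pad4_carrier (d : ℕ) (hd : 0 < d) (E₀ : AbelianVariety ℂ) (ψ₀ : E₀ ⟶ E₀) (hE : E₀.dim = 1)
    (hψ : ψ₀ ≫ ψ₀ = -(d • 𝟙 E₀)) :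
    ∃ (e : ProjectiveEmbedding (pad4Anchor E₀).X) (a : complexBetti (projectiveSpace e.n ℂ) 2)
      (w : complexBetti (pad4Anchor E₀).X (2 * 4)),
      IsRationalClass a ∧ a ≠ 0 ∧
      w ∈ weilClassesOf (pad4Anchor E₀) (pad4Action E₀ ψ₀) 4 d ∧ IsRationalClass w ∧ w ≠ 0 ∧
      HasLciCarrierAt 4 (pad4Anchor E₀) (symH d (pad4Action E₀ ψ₀) e a) w := by
  sorry

/-! ## §3 The ladder and the composition (no sorry below) -/

/-- The rung implies the sub-rung, statementwise (STUB C is on path). -/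
theorem pad4_carrier_of_seedAt (d : ℕ) (hd : 0 < d) (E₀ : AbelianVariety ℂ) (ψ₀ : E₀ ⟶ E₀) (hE : E₀.dim = 1)
    (hψ : ψ₀ ≫ ψ₀ = -(d • 𝟙 E₀)) :
    ∃ (e : ProjectiveEmbedding (pad4Anchor E₀).X) (a : complexBetti (projectiveSpace e.n ℂ) 2)
      (w : complexBetti (pad4Anchor E₀).X (2 * 4)),
      IsRationalClass a ∧ a ≠ 0 ∧
      w ∈ weilClassesOf (pad4Anchor E₀) (pad4Action E₀ ψ₀) 4 d ∧ IsRationalClass w ∧ w ≠ 0 ∧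
      HasLciCarrierAt 4 (pad4Anchor E₀) (symH d (pad4Action E₀ ψ₀) e a) w := by
  obtain ⟨e, a, w, ha, ha0, -, hwW, hwr, hw0, hseed⟩ := stub_rung_pad4_seedAt d hd E₀ ψ₀ hE hψ
  exact ⟨e, a, w, ha, ha0, hwW, hwr, hw0, hasLciCarrierAt_of_hasBlochSeedAt hseed⟩

/-- **Composition** (the ONLY theorem of this file concluding the crux): the CM curve `exists_cmCurve_sqrt_neg d`,
`dim S⁴ = 8`, `ψ² = -d` and STUB R give `BlochSeedsGeneric` BY NAME. -/
theorem BlochSeedsGeneric_of_pad4 :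
    Summit.HodgeConjecture.HodgeConjecture.Theses.EightfoldTwistedSheafSeeds.BlochSeedsGeneric := by
  intro d hd _ _
  obtain ⟨E₀, ψ₀, hE, hψ⟩ :=
    Literature.NumberTheory.EllipticCurves.CMEndomorphism.exists_cmCurve_sqrt_neg d hd
  obtain ⟨e, a, w, ha, ha0, hhyp, hwW, hwr, hw0, hseed⟩ := stub_rung_pad4_seedAt d hd E₀ ψ₀ hE hψ
  exact ⟨pad4Anchor E₀, pad4Action E₀ ψ₀, e, a, w, pad4Anchor_dim hE, pad4Action_comp_self hψ, ha, ha0, hhyp,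
    hwW, hwr, hw0, hseed⟩

end Summit.HodgeConjecture.HodgeConjecture.Cruxes.BlochSeedsGeneric.Pad4CMAnchor

end
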